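import Literature.Computation.Certificates.PatakiRankBoundBlocks

/-!
# Pataki's rank bound with FREE VARIABLES (Pataki 1998, Theorem 2.2 with `q` free variables, `d = 0`):
# an extreme point `((X_ρ)_ρ, y)` of a block SDP with free variables has `Σ_ρ t(rank X_ρ) + q ≤ m`,
# and its constraint map restricted to the ranges is injective ("vertex recovery is linear")

Source: G. Pataki, *On the rank of extreme matrices in semidefinite programs and the multiplicity of optimal
eigenvalues*, Math. Oper. Res. 23 (1998) 339–358 [Pataki1998], §2, **Theorem 2.2** (p. 343; held text
`paper:doi-10-1287-moor-23-2-339` p0005): for the feasible set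
`X₁ ⪰ 0, …, X_p ⪰ 0, y ∈ ℝ^q, Σ_j A_ij • X_j + Σ_j (free terms) = b_i (i = 1,…,m₁), …` and a face `G` of
dimension `d` containing `(X₁,…,X_p, y)` with `r_j = rank X_j`: "`Σ_{j=1}^p t(r_j) ≤ m − q + d`".
Here: scalar equality constraints only (`m₂ = 0`, constraints indexed by a finite type `κ`, `m = |κ|`),
`q = |φ|` free real variables entering linearly (`Σ_j B_ij y_j`), and `d = 0` (an extreme point):

  `(S, y) ∈ extremePoints ℝ {(S, y) : S_ρ ⪰ 0 ∀ρ, Σ_ρ tr(A_iρ S_ρ) + Σ_j B_ij y_j = c_i ∀ i}`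
  `⟹ Σ_ρ t(rank S_ρ) + |φ| ≤ |κ|`   (`sum_tri_rank_add_card_le_card_of_mem_extremePoints`).

The companion file `PatakiRankBoundBlocks` is the case `q = 0`; this file runs the SAME printed proof
("analogously to the proof of the first part of Theorem 2.1", p. 344) with the free block carried along:
* §1 a tuple `Δ = (Δ_ρ)` of symmetric `r_ρ × r_ρ` matrices and a free direction `μ ∈ ℝ^φ` solving the
  homogeneous reduced system `Σ_ρ tr(A_iρ V_ρ Δ_ρ V_ρᵀ) + Σ_j B_ij μ_j = 0` give the two feasible points
  `(S ± ε(V_ρ Δ_ρ V_ρᵀ)_ρ, y ± εμ)` for ONE `ε > 0` (`perturb_mem`, from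
  `PatakiRankBoundBlocks.exists_uniform_eps`), whose midpoint is `(S, y)`;
* §2 at an extreme point this forces `Δ = 0` AND `μ = 0` (`eq_zero_of_mem_extremePoints`), i.e. the linear
  map `F : (e, μ) ↦ (Σ_ρ tr(A_iρ V_ρ symOf(e_ρ) V_ρᵀ) + Σ_j B_ij μ_j)_i` is INJECTIVE
  (`injective_freeConstraintMap`) — the "extremality ⟺ the face map has full column rank" criterion used
  as **'vertex recovery is linear'** by the certified-many-body-solver cell hubbard-algo (p1 TARGET Thm J:
  with `Q_k` the ranges of an extreme multiplier, `(μ, Λ_k) ↦ A_eqᵀμ + Σ_k A_kᵀ svec(Q_kΛ_kQ_kᵀ)` is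
  injective and the multiplier is its unique preimage); the uniqueness is `eq_of_mem_of_range`: a feasible
  point whose blocks live on the same ranges, `S'_ρ = V_ρ M_ρ V_ρᵀ`, coincides with the extreme point;
* §3 comparing dimensions (`card_upperPair`): `Σ_ρ t(r_ρ) + |φ| ≤ |κ|`.

Everything is PROVED; the only definitions are the feasible set `blockFeasibleFree` and the linear map
`freeConstraintMap`; no named fact. NOT HERE: faces of positive dimension (`+ d`), matrix-valued equality
constraints (`m₂ > 0`), the dual form Thm 2.1 (2).
-/

noncomputable section

namespace Literature.Computation.Certificates.PatakiRankBoundFreeVariables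

open Matrix Finset
open PatakiRankBound (tri UpperPair card_upperPair symOf symOfLin symOfLin_apply symOf_injective
  isHermitian_symOf)
open PatakiRankBoundBlocks (exists_rank_factorization exists_uniform_eps)

variable {ι : Type*} [Fintype ι]
variable {nρ : ι → Type*} [∀ ρ, Fintype (nρ ρ)]
variable {κ : Type*} {φ : Type*} [Fintype φ]

/-! ## §0 The feasible set with free variables -/

/-- The feasible set `{((X_ρ)_ρ, y) : X_ρ ⪰ 0 ∀ρ, y free, Σ_ρ A_{iρ} • X_ρ + Σ_j B_{ij} y_j = c_i ∀ i}` of a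
semidefinite program with several semidefinite blocks, `q = |φ|` free variables and scalar equality
constraints (Thm 2.2 with `m₂ = 0`). [cite: Pataki1998, §2 Thm. 2.2 (feasible set, with `y ∈ ℝ^q`)] -/
def blockFeasibleFree (A : κ → ∀ ρ, Matrix (nρ ρ) (nρ ρ) ℝ) (B : κ → φ → ℝ) (c : κ → ℝ) :
    Set ((∀ ρ, Matrix (nρ ρ) (nρ ρ) ℝ) × (φ → ℝ)) :=
  {p | (∀ ρ, (p.1 ρ).PosSemidef) ∧ ∀ i, ∑ ρ, (A i ρ * p.1 ρ).trace + ∑ j, B i j * p.2 j = c i}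

omit [Fintype ι] [Fintype φ] in
/-- Membership in the feasible set with free variables. [cite: Pataki1998, §2 Thm. 2.2 (feasible set)] -/
theorem mem_blockFeasibleFree_iff [Fintype ι] [Fintype φ] {A : κ → ∀ ρ, Matrix (nρ ρ) (nρ ρ) ℝ}
    {B : κ → φ → ℝ} {c : κ → ℝ} {p : (∀ ρ, Matrix (nρ ρ) (nρ ρ) ℝ) × (φ → ℝ)} :
    p ∈ blockFeasibleFree A B c ↔
      (∀ ρ, (p.1 ρ).PosSemidef) ∧ ∀ i, ∑ ρ, (A i ρ * p.1 ρ).trace + ∑ j, B i j * p.2 j = c i :=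
  Iff.rfl

/-! ## §1 The perturbation `(S ± ε (V_ρ Δ_ρ V_ρᵀ)_ρ, y ± ε μ)` stays feasible -/

omit [Fintype ι] in
/-- `V M Vᵀ ⪰ 0` for `M ⪰ 0`. [folklore] -/
private theorem posSemidef_conj {ρ : ι} {r : ℕ} (V : Matrix (nρ ρ) (Fin r) ℝ)
    {M : Matrix (Fin r) (Fin r) ℝ} (hM : M.PosSemidef) : (V * M * Vᵀ).PosSemidef := by
  simpa [conjTranspose_eq_transpose_of_trivial] using hM.mul_mul_conjTranspose_same V

/-- (2.6) with free variables: if `S_ρ = V_ρ Λ_ρ V_ρᵀ`, `(S, y)` is feasible, `Λ_ρ ± εΔ_ρ ⪰ 0` for all `ρ`,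
and `(Δ, μ)` solves the homogeneous reduced system `Σ_ρ tr(A_iρ V_ρ Δ_ρ V_ρᵀ) + Σ_j B_ij μ_j = 0`, then
BOTH points `(S ± ε(V_ρ Δ_ρ V_ρᵀ)_ρ, y ± εμ)` are feasible.
[cite: Pataki1998, §2 proof of Thm. 2.1/2.2, eqs. (2.5)–(2.6)] -/
theorem perturb_mem {A : κ → ∀ ρ, Matrix (nρ ρ) (nρ ρ) ℝ} {B : κ → φ → ℝ} {c : κ → ℝ} {r : ι → ℕ}
    {V : ∀ ρ, Matrix (nρ ρ) (Fin (r ρ)) ℝ} {Λ Δ : ∀ ρ, Matrix (Fin (r ρ)) (Fin (r ρ)) ℝ}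
    {S : ∀ ρ, Matrix (nρ ρ) (nρ ρ) ℝ} {y μ : φ → ℝ} (hS : (S, y) ∈ blockFeasibleFree A B c)
    (hfac : ∀ ρ, S ρ = V ρ * Λ ρ * (V ρ)ᵀ)
    {ε : ℝ} (hε : ∀ ρ, (Λ ρ + ε • Δ ρ).PosSemidef ∧ (Λ ρ - ε • Δ ρ).PosSemidef)
    (hker : ∀ i, ∑ ρ, (A i ρ * (V ρ * Δ ρ * (V ρ)ᵀ)).trace + ∑ j, B i j * μ j = 0) :
    ((fun ρ => S ρ + ε • (V ρ * Δ ρ * (V ρ)ᵀ)), y + ε • μ) ∈ blockFeasibleFree A B c ∧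
      ((fun ρ => S ρ - ε • (V ρ * Δ ρ * (V ρ)ᵀ)), y - ε • μ) ∈ blockFeasibleFree A B c := by
  have hplus : ∀ ρ, S ρ + ε • (V ρ * Δ ρ * (V ρ)ᵀ) = V ρ * (Λ ρ + ε • Δ ρ) * (V ρ)ᵀ := by
    intro ρ; rw [hfac ρ, Matrix.mul_add, Matrix.add_mul, Matrix.mul_smul, Matrix.smul_mul]
  have hminus : ∀ ρ, S ρ - ε • (V ρ * Δ ρ * (V ρ)ᵀ) = V ρ * (Λ ρ - ε • Δ ρ) * (V ρ)ᵀ := by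
    intro ρ; rw [hfac ρ, Matrix.mul_sub, Matrix.sub_mul, Matrix.mul_smul, Matrix.smul_mul]
  -- the affine constraints along the line `σ ↦ (S + σ W, y + σ μ)`
  have hlin : ∀ i (σ : ℝ),
      ∑ ρ, (A i ρ * (S ρ + σ • (V ρ * Δ ρ * (V ρ)ᵀ))).trace + ∑ j, B i j * (y + σ • μ) j = c i := by
    intro i σ
    have h1 : ∀ ρ, (A i ρ * (S ρ + σ • (V ρ * Δ ρ * (V ρ)ᵀ))).trace
        = (A i ρ * S ρ).trace + σ * (A i ρ * (V ρ * Δ ρ * (V ρ)ᵀ)).trace := by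
      intro ρ; rw [Matrix.mul_add, trace_add, Matrix.mul_smul, trace_smul, smul_eq_mul]
    have h2 : ∀ j, B i j * (y + σ • μ) j = B i j * y j + σ * (B i j * μ j) := by
      intro j; simp only [Pi.add_apply, Pi.smul_apply, smul_eq_mul]; ring
    simp only [h1, h2, Finset.sum_add_distrib, ← Finset.mul_sum]
    have h3 := hker i
    have h4 := hS.2 i
    simp only at h4
    calc (∑ ρ, (A i ρ * S ρ).trace + σ * ∑ ρ, (A i ρ * (V ρ * Δ ρ * (V ρ)ᵀ)).trace) +
          (∑ j, B i j * y j + σ * ∑ j, B i j * μ j)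
        = (∑ ρ, (A i ρ * S ρ).trace + ∑ j, B i j * y j) +
          σ * (∑ ρ, (A i ρ * (V ρ * Δ ρ * (V ρ)ᵀ)).trace + ∑ j, B i j * μ j) := by ring
      _ = c i := by rw [h3, h4, mul_zero, add_zero]
  refine ⟨⟨fun ρ => ?_, fun i => hlin i ε⟩, ⟨fun ρ => ?_, fun i => ?_⟩⟩
  · show (S ρ + ε • (V ρ * Δ ρ * (V ρ)ᵀ)).PosSemidef
    rw [hplus ρ]; exact posSemidef_conj (V ρ) (hε ρ).1
  · show (S ρ - ε • (V ρ * Δ ρ * (V ρ)ᵀ)).PosSemidef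
    rw [hminus ρ]; exact posSemidef_conj (V ρ) (hε ρ).2
  · have := hlin i (-ε)
    simpa [sub_eq_add_neg] using this

/-! ## §2 At an extreme point the reduced homogeneous system has only the trivial solution -/

/-- THE EXTREME-POINT STEP with free variables: with `S_ρ = V_ρ Λ_ρ V_ρᵀ`, `(S, y)` an extreme point of the
feasible set, `Λ_ρ ≻ 0`, `V_ρᵀ V_ρ = 1`, every solution `(Δ, μ)` (all `Δ_ρ` symmetric) of
`Σ_ρ tr(A_iρ V_ρ Δ_ρ V_ρᵀ) + Σ_j B_ij μ_j = 0 ∀ i` is trivial: `Δ = 0` and `μ = 0` (otherwise `(S, y)` is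
the midpoint of the two feasible points of `perturb_mem`).
[cite: Pataki1998, §2 proof of Thm. 2.1/2.2, eqs. (2.4)–(2.6)] -/
theorem eq_zero_of_mem_extremePoints {A : κ → ∀ ρ, Matrix (nρ ρ) (nρ ρ) ℝ} {B : κ → φ → ℝ} {c : κ → ℝ}
    {r : ι → ℕ} {V : ∀ ρ, Matrix (nρ ρ) (Fin (r ρ)) ℝ} {Λ Δ : ∀ ρ, Matrix (Fin (r ρ)) (Fin (r ρ)) ℝ}
    {S : ∀ ρ, Matrix (nρ ρ) (nρ ρ) ℝ} {y μ : φ → ℝ}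
    (hS : (S, y) ∈ Set.extremePoints ℝ (blockFeasibleFree A B c))
    (hfac : ∀ ρ, S ρ = V ρ * Λ ρ * (V ρ)ᵀ) (hΛ : ∀ ρ, (Λ ρ).PosDef) (hVV : ∀ ρ, (V ρ)ᵀ * V ρ = 1)
    (hΔ : ∀ ρ, (Δ ρ).IsHermitian)
    (hker : ∀ i, ∑ ρ, (A i ρ * (V ρ * Δ ρ * (V ρ)ᵀ)).trace + ∑ j, B i j * μ j = 0) :
    Δ = 0 ∧ μ = 0 := by
  obtain ⟨ε, hεpos, hε⟩ := exists_uniform_eps hΛ hΔ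
  rw [mem_extremePoints] at hS
  obtain ⟨hSmem, hext⟩ := hS
  obtain ⟨hplus, hminus⟩ := perturb_mem hSmem hfac hε hker
  set W : ∀ ρ, Matrix (nρ ρ) (nρ ρ) ℝ := fun ρ => V ρ * Δ ρ * (V ρ)ᵀ with hW
  have hseg : (S, y) ∈ openSegment ℝ ((fun ρ => S ρ + ε • W ρ), y + ε • μ)
      ((fun ρ => S ρ - ε • W ρ), y - ε • μ) := by
    refine ⟨1 / 2, 1 / 2, by norm_num, by norm_num, by norm_num, Prod.ext ?_ ?_⟩
    · funext ρ
      simp only [Prod.smul_fst, Prod.fst_add, Pi.add_apply, Pi.smul_apply]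
      module
    · simp only [Prod.smul_snd, Prod.snd_add]
      module
  have h1 : ((fun ρ => S ρ + ε • W ρ), y + ε • μ) = (S, y) := (hext _ hplus _ hminus hseg).1
  have h1S : (fun ρ => S ρ + ε • W ρ) = S := congr_arg Prod.fst h1
  have h1y : y + ε • μ = y := congr_arg Prod.snd h1
  refine ⟨?_, ?_⟩
  · funext ρ
    have h2 : ε • W ρ = 0 := by
      have := congr_fun h1S ρ
      simpa using this
    have hW0 : W ρ = 0 := by
      rcases smul_eq_zero.mp h2 with h | h
      · exact absurd h hεpos.ne'
      · exact h
    -- `Δ_ρ = V_ρᵀ (V_ρ Δ_ρ V_ρᵀ) V_ρ = 0`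
    have : Δ ρ = (V ρ)ᵀ * W ρ * V ρ := by
      simp only [hW]
      rw [← Matrix.mul_assoc, ← Matrix.mul_assoc, hVV, Matrix.one_mul, Matrix.mul_assoc, hVV,
        Matrix.mul_one]
    rw [this, hW0, Matrix.mul_zero, Matrix.zero_mul]
    rfl
  · have h2 : ε • μ = 0 := by
      have := h1y
      simpa using this
    rcases smul_eq_zero.mp h2 with h | h
    · exact absurd h hεpos.ne'
    · exact h

/-- UNIQUENESS ON THE RANGES ("vertex recovery"): if `(S, y)` is an extreme point with
`S_ρ = V_ρ Λ_ρ V_ρᵀ`, `Λ_ρ ≻ 0`, `V_ρᵀ V_ρ = 1`, then every feasible point whose blocks are supported on the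
same ranges, `S'_ρ = V_ρ M_ρ V_ρᵀ` with `M_ρ` symmetric, IS `(S, y)`: `M = Λ` and `y' = y`. Hence the
extreme point is the UNIQUE solution of the linear feasibility system restricted to its ranges.
[cite: Pataki1998, §2 Thm. 2.2 and proof of Thm. 2.1, eqs. (2.4)–(2.6)] -/
theorem eq_of_mem_of_range {A : κ → ∀ ρ, Matrix (nρ ρ) (nρ ρ) ℝ} {B : κ → φ → ℝ} {c : κ → ℝ}
    {r : ι → ℕ} {V : ∀ ρ, Matrix (nρ ρ) (Fin (r ρ)) ℝ} {Λ M : ∀ ρ, Matrix (Fin (r ρ)) (Fin (r ρ)) ℝ}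
    {S : ∀ ρ, Matrix (nρ ρ) (nρ ρ) ℝ} {y y' : φ → ℝ}
    (hS : (S, y) ∈ Set.extremePoints ℝ (blockFeasibleFree A B c))
    (hfac : ∀ ρ, S ρ = V ρ * Λ ρ * (V ρ)ᵀ) (hΛ : ∀ ρ, (Λ ρ).PosDef) (hVV : ∀ ρ, (V ρ)ᵀ * V ρ = 1)
    (hM : ∀ ρ, (M ρ).IsHermitian)
    (hS' : ((fun ρ => V ρ * M ρ * (V ρ)ᵀ), y') ∈ blockFeasibleFree A B c) :
    M = Λ ∧ y' = y := by
  -- `(M − Λ, y' − y)` solves the homogeneous reduced system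
  have hker : ∀ i, ∑ ρ, (A i ρ * (V ρ * (M ρ - Λ ρ) * (V ρ)ᵀ)).trace + ∑ j, B i j * (y' - y) j = 0 := by
    intro i
    have h1 := hS'.2 i
    have h2 := hS.1.2 i
    simp only at h1 h2
    have h3 : ∀ ρ, (A i ρ * (V ρ * (M ρ - Λ ρ) * (V ρ)ᵀ)).trace
        = (A i ρ * (V ρ * M ρ * (V ρ)ᵀ)).trace - (A i ρ * S ρ).trace := by
      intro ρ
      rw [hfac ρ, Matrix.mul_sub, Matrix.sub_mul, Matrix.mul_sub, trace_sub]
    have h4 : ∀ j, B i j * (y' - y) j = B i j * y' j - B i j * y j := by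
      intro j; simp only [Pi.sub_apply]; ring
    simp only [h3, h4, Finset.sum_sub_distrib]
    linarith
  have hΔ : ∀ ρ, (M ρ - Λ ρ).IsHermitian := fun ρ => (hM ρ).sub (hΛ ρ).isHermitian
  obtain ⟨hD, hμ⟩ := eq_zero_of_mem_extremePoints hS hfac hΛ hVV hΔ hker
  refine ⟨?_, ?_⟩
  · funext ρ
    have := congr_fun hD ρ
    simpa [sub_eq_zero] using this
  · simpa [sub_eq_zero] using hμ

/-! ## §3 The constraint map on the ranges is injective; dimension count `Σ_ρ t(r_ρ) + |φ| ≤ |κ|` -/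

/-- The reduced constraint map on upper-triangular coordinates and the free variables:
`(e, μ) ↦ (Σ_ρ tr(A_iρ V_ρ symOf(e_ρ) V_ρᵀ) + Σ_j B_ij μ_j)_i`, a linear map
`(Π_ρ ℝ^{t(r_ρ)}) × ℝ^φ → ℝ^κ` (the 'face map' of a point with ranges `V_ρ`).
[cite: Pataki1998, §2 proof of Thm. 2.1/2.2, eq. (2.4)] -/
def freeConstraintMap (A : κ → ∀ ρ, Matrix (nρ ρ) (nρ ρ) ℝ) (B : κ → φ → ℝ) {r : ι → ℕ}
    (V : ∀ ρ, Matrix (nρ ρ) (Fin (r ρ)) ℝ) :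
    ((∀ ρ, UpperPair (r ρ) → ℝ) × (φ → ℝ)) →ₗ[ℝ] (κ → ℝ) where
  toFun p i := ∑ ρ, (A i ρ * (V ρ * symOf (p.1 ρ) * (V ρ)ᵀ)).trace + ∑ j, B i j * p.2 j
  map_add' p₁ p₂ := by
    funext i
    simp only [Prod.fst_add, Prod.snd_add, Pi.add_apply]
    have h1 : ∀ ρ, (A i ρ * (V ρ * symOf (p₁.1 ρ + p₂.1 ρ) * (V ρ)ᵀ)).trace
        = (A i ρ * (V ρ * symOf (p₁.1 ρ) * (V ρ)ᵀ)).trace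
          + (A i ρ * (V ρ * symOf (p₂.1 ρ) * (V ρ)ᵀ)).trace := by
      intro ρ
      rw [← symOfLin_apply, map_add, symOfLin_apply, symOfLin_apply, Matrix.mul_add,
        Matrix.add_mul, Matrix.mul_add, trace_add]
    have h2 : ∀ j, B i j * (p₁.2 j + p₂.2 j) = B i j * p₁.2 j + B i j * p₂.2 j := fun j => mul_add _ _ _
    simp only [h1, h2, Finset.sum_add_distrib]
    ring
  map_smul' a p := by
    funext i
    simp only [Prod.smul_fst, Prod.smul_snd, Pi.smul_apply, smul_eq_mul, RingHom.id_apply]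
    have h1 : ∀ ρ, (A i ρ * (V ρ * symOf (a • p.1 ρ) * (V ρ)ᵀ)).trace
        = a * (A i ρ * (V ρ * symOf (p.1 ρ) * (V ρ)ᵀ)).trace := by
      intro ρ
      rw [← symOfLin_apply, map_smul, symOfLin_apply, Matrix.mul_smul, Matrix.smul_mul,
        Matrix.mul_smul, trace_smul, smul_eq_mul]
    have h2 : ∀ j, B i j * (a * p.2 j) = a * (B i j * p.2 j) := fun j => by ring
    simp only [h1, h2, ← Finset.mul_sum]
    ring

/-- **'Vertex recovery is linear'**: at an extreme point `(S, y)` with `S_ρ = V_ρ Λ_ρ V_ρᵀ`, `Λ_ρ ≻ 0`,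
`V_ρᵀ V_ρ = 1`, the face map `(e, μ) ↦ (Σ_ρ tr(A_iρ V_ρ symOf(e_ρ) V_ρᵀ) + Σ_j B_ij μ_j)_i` is
INJECTIVE (full column rank). [cite: Pataki1998, §2 Thm. 2.2 and proof of Thm. 2.1, eqs. (2.4)–(2.6)] -/
theorem injective_freeConstraintMap {A : κ → ∀ ρ, Matrix (nρ ρ) (nρ ρ) ℝ} {B : κ → φ → ℝ} {c : κ → ℝ}
    {r : ι → ℕ} {V : ∀ ρ, Matrix (nρ ρ) (Fin (r ρ)) ℝ} {Λ : ∀ ρ, Matrix (Fin (r ρ)) (Fin (r ρ)) ℝ}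
    {S : ∀ ρ, Matrix (nρ ρ) (nρ ρ) ℝ} {y : φ → ℝ}
    (hS : (S, y) ∈ Set.extremePoints ℝ (blockFeasibleFree A B c))
    (hfac : ∀ ρ, S ρ = V ρ * Λ ρ * (V ρ)ᵀ) (hΛ : ∀ ρ, (Λ ρ).PosDef) (hVV : ∀ ρ, (V ρ)ᵀ * V ρ = 1) :
    Function.Injective (freeConstraintMap A B V) := by
  refine (injective_iff_map_eq_zero _).mpr fun p hp => ?_
  have h := eq_zero_of_mem_extremePoints (Δ := fun ρ => symOf (p.1 ρ)) (μ := p.2) hS hfac hΛ hVV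
    (fun ρ => isHermitian_symOf (p.1 ρ)) (fun i => congr_fun hp i)
  obtain ⟨hΔ, hμ⟩ := h
  refine Prod.ext ?_ ?_
  · funext ρ q
    have h0 : symOf (p.1 ρ) = symOf (0 : UpperPair (r ρ) → ℝ) := by
      have hz : symOf (0 : UpperPair (r ρ) → ℝ) = 0 := by rw [← symOfLin_apply, map_zero]
      rw [hz]; exact congr_fun hΔ ρ
    have := congr_fun (symOf_injective (r ρ) h0) q
    simpa using this
  · funext j
    simpa using congr_fun hμ j

/-- **Theorem 2.2 (Pataki 1998) with free variables, `d = 0`, rank form.** If `((S_ρ)_ρ, y)` is an extreme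
point of `{(S, y) : S_ρ ⪰ 0 ∀ρ, Σ_ρ A_{iρ} • S_ρ + Σ_j B_{ij} y_j = c_i ∀ i ∈ κ}` (`y ∈ ℝ^φ` free), then
`Σ_ρ t(rank S_ρ) + |φ| ≤ |κ|` (`t(r) = r(r+1)/2`): free variables LOWER the few-squares budget.
[cite: Pataki1998, §2 Thm. 2.2] -/
theorem sum_tri_rank_add_card_le_card_of_mem_extremePoints [∀ ρ, DecidableEq (nρ ρ)] [Fintype κ]
    {A : κ → ∀ ρ, Matrix (nρ ρ) (nρ ρ) ℝ} {B : κ → φ → ℝ} {c : κ → ℝ}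
    {S : ∀ ρ, Matrix (nρ ρ) (nρ ρ) ℝ} {y : φ → ℝ}
    (hS : (S, y) ∈ Set.extremePoints ℝ (blockFeasibleFree A B c)) :
    ∑ ρ, tri ((S ρ).rank) + Fintype.card φ ≤ Fintype.card κ := by
  have hSmem : (S, y) ∈ blockFeasibleFree A B c := hS.1
  have hfac := fun ρ => exists_rank_factorization (hSmem.1 ρ)
  choose r V d hrank hdpos hVV hSeq using hfac
  have hΛ : ∀ ρ, (diagonal (d ρ)).PosDef := fun ρ => Matrix.posDef_diagonal_iff.mpr (hdpos ρ)
  have hinj := injective_freeConstraintMap (Λ := fun ρ => diagonal (d ρ)) hS hSeq hΛ hVV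
  have hdim := LinearMap.finrank_le_finrank_of_injective hinj
  rw [Module.finrank_prod, Module.finrank_pi_fintype ℝ, Module.finrank_fintype_fun_eq_card,
    Module.finrank_fintype_fun_eq_card] at hdim
  simp only [Module.finrank_fintype_fun_eq_card, card_upperPair] at hdim
  calc ∑ ρ, tri ((S ρ).rank) + Fintype.card φ = ∑ ρ, tri (r ρ) + Fintype.card φ := by
        rw [Finset.sum_congr rfl fun ρ _ => by rw [hrank ρ]]
    _ ≤ Fintype.card κ := hdim

/-- The same with `t` unfolded, `κ = Fin f` constraints and `φ = Fin q` free variables: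
`Σ_ρ rank(S_ρ)(rank(S_ρ)+1)/2 + q ≤ f`. [cite: Pataki1998, §2 Thm. 2.2] -/
theorem sum_rank_mul_succ_div_two_add_le_of_mem_extremePoints [∀ ρ, DecidableEq (nρ ρ)] {f q : ℕ}
    {A : Fin f → ∀ ρ, Matrix (nρ ρ) (nρ ρ) ℝ} {B : Fin f → Fin q → ℝ} {c : Fin f → ℝ}
    {S : ∀ ρ, Matrix (nρ ρ) (nρ ρ) ℝ} {y : Fin q → ℝ}
    (hS : (S, y) ∈ Set.extremePoints ℝ (blockFeasibleFree A B c)) :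
    ∑ ρ, (S ρ).rank * ((S ρ).rank + 1) / 2 + q ≤ f := by
  have h := sum_tri_rank_add_card_le_card_of_mem_extremePoints hS
  simpa [tri, Fintype.card_fin] using h

end Literature.Computation.Certificates.PatakiRankBoundFreeVariables
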